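import Literature.NumberTheory.EllipticCurves.BinaryQuarticDoubleRootStructureProofs
import Mathlib.FieldTheory.Finite.Basic
import HarnessLib

/-!
# Smooth points on `z² = (x − r)²·k(x)` over a finite field: the splitting types `(1²11)` and
# `(1²2)` of Bhargava–Shankar's Prop. 5.13 / Prop. 3.18

`Proofs` companion (theorems only: no definitions, no named facts) of `BinaryQuarticForms.lean`
and `BinaryQuarticDoubleRootStructureProofs.lean` (case 3 of `BinaryQuartic.doubleRoot_structure`:
`f = (x − ry)²·(k₀x² + k₁xy + k₂y²)`, `k(r,1) ≠ 0`, `disc(k) ≠ 0`).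

Source and role. M. Bhargava, A. Shankar, *Binary quartic forms having bounded invariants, and the
boundedness of the average rank of elliptic curves*, Ann. of Math. (2) 181 (2015) 191–242, proof
of Prop. 5.13 of the held arXiv text `arXiv:1006.1002v2` (= Prop. 3.18 of the published version):
*"If the splitting type of `f` at `p` is `(1²11)` or `(1³1)`, then the reduction of `f` modulo `p`
has a single root in `ℙ¹(𝔽_p)`, which lifts to a root in `ℙ¹(ℚ_p)` by Hensel's Lemma. Thus `f`
is `ℚ_p`-soluble"*, together with the companion case `(1²2)`, where the simple roots are not
rational but `f` takes a nonzero square value next to the node. This file produces, over a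
finite field `F` with `2 ≠ 0`, `3 ≠ 0`, the **smooth `F`-point of `z² = f(x, 1)`** that Hensel's
lemma needs (`BinaryQuartic.isSoluble_of_smooth_point_mod_p` of `BinaryQuarticHenselSolubility`):

* `BinaryQuartic.exists_smooth_point_of_doubleRoot`: if `f = (x − ry)²·k` with `k(r,1) ≠ 0` and
  `disc(k) ≠ 0`, there are `t, w ∈ F` with `w² = f(t, 1)` and (`w ≠ 0` or `∂f/∂x(t,1) ≠ 0`).

If `k` has a root `t₀ ∈ F` (type `(1²11)`), `t₀ ≠ r` is a simple root of `f(·,1)`. Otherwise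
(type `(1²2)`, `k = k₀((x + c)² − E)` with `E` a non-square) one needs `s ≠ 0` with
`k₀(s² − E)` a nonzero square — then one of `t = ±s − c` avoids `r` and `f(t,1) = (t−r)²k(t)` is
a nonzero square. The existence of `s` (`exists_ne_zero_sq_eq_mul_sq_sub`) is proved by a
character-free counting argument: the **Jacobsthal-type identity `Σ_{x ∈ F} (x² − E)^{(q−1)/2} = −1`**
(`sum_sq_sub_pow_card_div_two`, from `Σ_x x^i = 0` for `0 ≤ i < q − 1`) is incompatible with
`k₀(s² − E)` being a non-square for every `s ≠ 0` (Euler's criterion would give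
`Σ_x (x² − E)^{(q−1)/2} = ±1 ± 1 ∈ {0, ±2}`, and `−1 ∉ {0, ±2}` as `2, 3 ≠ 0`).

## References

* M. Bhargava, A. Shankar, Ann. of Math. (2) 181 (2015), proof of Prop. 5.13 (arXiv:1006.1002v2
  numbering) = Prop. 3.18 (published). [cite: BhargavaShankarAnnals2015, Prop. 5.13, proof (arXiv:1006.1002v2 numbering)]
-/

noncomputable section

open scoped Classical
open Finset

namespace Literature.NumberTheory.EllipticCurves

namespace BinaryQuartic

variable {F : Type*} [Field F] [Fintype F]

omit [Fintype F] in
/-- `2 ≠ 0` in `F` means the characteristic is not `2`. [folklore] -/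
theorem ringChar_ne_two_of_two_ne_zero (h2 : (2 : F) ≠ 0) : ringChar F ≠ 2 := by
  intro h
  apply h2
  have := ringChar.Nat.cast_ringChar (R := F)
  rw [h] at this
  exact_mod_cast this

/-- Power sums over a finite field: `Σ_x x^{2j} = 0` for `2j < q − 1` and `Σ_x x^{q−1} = −1`.
[folklore] -/
theorem sum_pow_two_mul (h2 : (2 : F) ≠ 0) {j : ℕ} (hj : j ≤ Fintype.card F / 2) :
    ∑ x : F, x ^ (2 * j) = if j = Fintype.card F / 2 then -1 else 0 := by
  have hodd := FiniteField.odd_card_of_char_ne_two (ringChar_ne_two_of_two_ne_zero h2)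
  have hq : Fintype.card F = 2 * (Fintype.card F / 2) + 1 := by
    have := Nat.div_add_mod (Fintype.card F) 2
    omega
  split_ifs with h
  · -- `Σ_x x^{q-1} = #Fˣ = q - 1 = -1`
    have hq1 : 2 * j = Fintype.card F - 1 := by omega
    rw [hq1]
    have : ∀ x : F, x ^ (Fintype.card F - 1) = if x = 0 then 0 else 1 := fun x ↦ by
      split_ifs with hx
      · have := Fintype.one_lt_card (α := F)
        rw [hx, zero_pow]; omega
      · exact FiniteField.pow_card_sub_one_eq_one x hx
    simp_rw [this]
    rw [Finset.sum_ite, Finset.sum_const_zero, zero_add, Finset.sum_const, nsmul_eq_mul, mul_one,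
      Finset.filter_ne' Finset.univ (0 : F), Finset.card_erase_of_mem (Finset.mem_univ _),
      Finset.card_univ, Nat.cast_sub Fintype.card_pos, FiniteField.cast_card_eq_zero, Nat.cast_one,
      zero_sub]
  · apply FiniteField.sum_pow_lt_card_sub_one
    omega

/-- **Jacobsthal-type identity: `Σ_{x ∈ F} (x² − E)^{(q−1)/2} = −1`** for every `E` in a finite
field of odd cardinality `q` (expand by the binomial theorem; only the top power sum survives).
[folklore] -/
theorem sum_sq_sub_pow_card_div_two (h2 : (2 : F) ≠ 0) (E : F) :
    ∑ x : F, (x ^ 2 - E) ^ (Fintype.card F / 2) = -1 := by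
  set m := Fintype.card F / 2 with hm
  have hexp : ∀ x : F, (x ^ 2 - E) ^ m =
      ∑ j ∈ range (m + 1), x ^ (2 * j) * ((-E) ^ (m - j) * (m.choose j : F)) := fun x ↦ by
    rw [sub_eq_add_neg, add_pow]
    refine Finset.sum_congr rfl fun j _ ↦ ?_
    rw [pow_mul]; ring
  simp_rw [hexp]
  rw [Finset.sum_comm]
  simp_rw [← Finset.sum_mul]
  rw [Finset.sum_eq_single m]
  · rw [sum_pow_two_mul h2 le_rfl, if_pos rfl, Nat.sub_self, pow_zero, Nat.choose_self,
      Nat.cast_one]; ring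
  · intro j hj hjm
    have hj' : j ≤ m := Nat.lt_succ_iff.mp (Finset.mem_range.mp hj)
    rw [sum_pow_two_mul h2 hj', if_neg hjm, zero_mul]
  · intro h; exact absurd (Finset.self_mem_range_succ m) h

/-- **Next to a node one finds a nonzero square**: for `k₀ ≠ 0` and a non-square `E` in a finite
field with `2 ≠ 0`, `3 ≠ 0`, there is `s ≠ 0` with `k₀(s² − E)` a nonzero square. (If not,
Euler's criterion makes `(k₀(s² − E))^{(q−1)/2} = −1` for all `s ≠ 0`, so
`Σ_x (x² − E)^{(q−1)/2} = (−E)^{(q−1)/2} − (q−1)·k₀^{−(q−1)/2} = ±1 ± 1`, contradicting the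
Jacobsthal identity.) [folklore] -/
theorem exists_ne_zero_sq_eq_mul_sq_sub (h2 : (2 : F) ≠ 0) (h3 : (3 : F) ≠ 0) {k₀ E : F}
    (hk₀ : k₀ ≠ 0) (hE : ¬ IsSquare E) :
    ∃ s v : F, s ≠ 0 ∧ v ≠ 0 ∧ v ^ 2 = k₀ * (s ^ 2 - E) := by
  have hF := ringChar_ne_two_of_two_ne_zero h2
  have hE0 : E ≠ 0 := by rintro rfl; exact hE ⟨0, by ring⟩
  have hsE : ∀ s : F, s ^ 2 - E ≠ 0 := fun s h ↦ hE ⟨s, by rw [← sq]; linear_combination -h⟩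
  by_contra H
  simp only [not_exists, not_and] at H
  -- every `k₀(s² − E)`, `s ≠ 0`, is a non-square, so its `(q−1)/2`-th power is `-1`
  have hpow : ∀ s : F, s ≠ 0 → (k₀ * (s ^ 2 - E)) ^ (Fintype.card F / 2) = -1 := by
    intro s hs
    have hne : k₀ * (s ^ 2 - E) ≠ 0 := mul_ne_zero hk₀ (hsE s)
    rcases FiniteField.pow_dichotomy hF hne with h | h
    · exfalso
      obtain ⟨v, hv⟩ := (FiniteField.isSquare_iff hF hne).mpr h
      have hv0 : v ≠ 0 := by rintro rfl; rw [mul_zero] at hv; exact hne hv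
      exact H s v hs hv0 (by rw [sq]; exact hv.symm)
    · exact h
  have key := sum_sq_sub_pow_card_div_two h2 E
  rw [← Finset.add_sum_erase _ _ (Finset.mem_univ (0 : F))] at key
  have hrest : ∀ x ∈ Finset.univ.erase (0 : F),
      (x ^ 2 - E) ^ (Fintype.card F / 2) = -(k₀ ^ (Fintype.card F / 2)) := by
    intro x hx
    have hx0 : x ≠ 0 := Finset.ne_of_mem_erase hx
    have h := hpow x hx0
    rw [mul_pow] at h
    rcases FiniteField.pow_dichotomy hF hk₀ with h₀ | h₀ <;> rw [h₀] at h ⊢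
    · linear_combination h
    · linear_combination -h
  have hm : Fintype.card F / 2 ≠ 0 := by
    have := Fintype.one_lt_card (α := F); omega
  rw [Finset.sum_congr rfl hrest, Finset.sum_const, Finset.card_erase_of_mem (Finset.mem_univ _),
    Finset.card_univ, nsmul_eq_mul, Nat.cast_sub Fintype.card_pos, FiniteField.cast_card_eq_zero,
    Nat.cast_one, zero_sub, zero_pow two_ne_zero, zero_sub] at key
  -- `key : (-E)^m + (-1) * -(k₀^m) = -1` with both powers `= ±1`
  rcases FiniteField.pow_dichotomy hF hk₀ with h₀ | h₀ <;>
    rcases FiniteField.pow_dichotomy hF (neg_ne_zero.mpr hE0) with h₁ | h₁ <;>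
    rw [h₀, h₁] at key
  · exact h3 (by linear_combination key)
  · exact one_ne_zero (by linear_combination key)
  · exact one_ne_zero (by linear_combination key)
  · exact one_ne_zero (by linear_combination -key)

/-- **A smooth point of `z² = f(x,1)` at splitting type `(1²11)`/`(1²2)`** (input of Hensel's lemma
in the proof of Bhargava–Shankar's Prop. 5.13 / Prop. 3.18): if `f = (x − ry)²·(k₀x² + k₁xy + k₂y²)`
over a finite field with `2 ≠ 0`, `3 ≠ 0`, `k(r,1) ≠ 0`, `disc(k) ≠ 0`, then there are
`t, w ∈ F` with `w² = f(t,1)` and `w ≠ 0` or `∂f/∂x(t, 1) ≠ 0`.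
[cite: BhargavaShankarAnnals2015, Prop. 5.13, proof (arXiv:1006.1002v2 numbering)] -/
theorem exists_smooth_point_of_doubleRoot (h2 : (2 : F) ≠ 0) (h3 : (3 : F) ≠ 0)
    {f : BinaryQuartic F} {r k₀ k₁ k₂ : F} (ha : f.a = k₀) (hb : f.b = k₁ - 2 * r * k₀)
    (hc : f.c = k₂ - 2 * r * k₁ + r ^ 2 * k₀) (hd : f.d = -2 * r * k₂ + r ^ 2 * k₁)
    (he : f.e = r ^ 2 * k₂) (hk : k₀ * r ^ 2 + k₁ * r + k₂ ≠ 0) (hD : k₁ ^ 2 - 4 * k₀ * k₂ ≠ 0) :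
    ∃ t w : F, w ^ 2 = f.eval t 1 ∧
      (w ≠ 0 ∨ 4 * f.a * t ^ 3 + 3 * f.b * t ^ 2 + 2 * f.c * t + f.d ≠ 0) := by
  have hev : ∀ t, f.eval t 1 = (t - r) ^ 2 * (k₀ * t ^ 2 + k₁ * t + k₂) := fun t ↦ by
    rw [eval_eq_of_doubleRoot ha hb hc hd he]; ring
  have hder : ∀ t, 4 * f.a * t ^ 3 + 3 * f.b * t ^ 2 + 2 * f.c * t + f.d =
      2 * (t - r) * (k₀ * t ^ 2 + k₁ * t + k₂) + (t - r) ^ 2 * (2 * k₀ * t + k₁) := fun t ↦ by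
    rw [ha, hb, hc, hd]; ring
  by_cases hroot : ∃ t₀ : F, k₀ * t₀ ^ 2 + k₁ * t₀ + k₂ = 0
  · -- type `(1²11)`: a simple rational root of `k`
    obtain ⟨t₀, ht₀⟩ := hroot
    refine ⟨t₀, 0, by rw [hev, ht₀]; ring, Or.inr ?_⟩
    rw [hder, ht₀, mul_zero, zero_add]
    have htr : t₀ - r ≠ 0 := by
      intro h
      rw [sub_eq_zero] at h
      rw [h] at ht₀
      exact hk ht₀
    have hk' : 2 * k₀ * t₀ + k₁ ≠ 0 := fun h ↦ hD (by
      linear_combination (2 * k₀ * t₀ + k₁) * h + (-4 * k₀) * ht₀)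
    exact mul_ne_zero (pow_ne_zero _ htr) hk'
  · -- type `(1²2)`: `k` irreducible; find a nonzero square value of `k` away from `r`
    simp only [not_exists] at hroot
    have hk₀ : k₀ ≠ 0 := by
      intro h0
      have hk₁ : k₁ ≠ 0 := by
        intro h1; apply hD; rw [h0, h1]; ring
      apply hroot (-k₂ / k₁)
      rw [h0]; field_simp; ring
    have h4 : (4 : F) ≠ 0 := by rw [show (4 : F) = 2 * 2 by norm_num]; exact mul_ne_zero h2 h2
    set c := k₁ / (2 * k₀) with hcdef
    set E := (k₁ ^ 2 - 4 * k₀ * k₂) / (4 * k₀ ^ 2) with hEdef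
    have hkE : ∀ t, k₀ * t ^ 2 + k₁ * t + k₂ = k₀ * ((t + c) ^ 2 - E) := fun t ↦ by
      rw [hcdef, hEdef]; field_simp; ring
    have hE : ¬ IsSquare E := by
      rintro ⟨u, hu⟩
      apply hroot (u - c)
      rw [hkE, sub_add_cancel, hu]; ring
    obtain ⟨s, v, hs, hv, hsv⟩ := exists_ne_zero_sq_eq_mul_sq_sub h2 h3 hk₀ hE
    -- one of `±s − c` avoids `r`
    obtain ⟨t, htr, hts⟩ : ∃ t : F, t ≠ r ∧ (t + c) ^ 2 = s ^ 2 := by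
      by_cases h : s - c = r
      · refine ⟨-s - c, fun h' ↦ hs ?_, by ring⟩
        have : (2 : F) * s = 0 := by linear_combination h - h'
        exact (mul_eq_zero.mp this).resolve_left h2
      · exact ⟨s - c, h, by ring⟩
    refine ⟨t, (t - r) * v, ?_, Or.inl (mul_ne_zero (sub_ne_zero.mpr htr) hv)⟩
    rw [hev, hkE, hts, ← hsv]; ring

end BinaryQuartic

end Literature.NumberTheory.EllipticCurves

end
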